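import Summits.Schanuel.Schanuel.Theorems.RootDecomp1BSRLLogLiouville01

/-!
# RootDecomp1BSRLLogLiouville — lens 4, generation 29 «SRL LOG-LIOUVILLE COLUMN» (SRLLogLiouvilleColumn.lean 82cb1698…, 650 l) — continuation (RootDecomp1BSRLLogLiouville02): §4 flagships (λ_H, Liouville's constant ℓ₁₀: `cell_one_log_lambdaH`, `cell_sqrt_two_log_liouvilleNumber_ten`, `cell_one_sqrt_two_log_lambdaH`), §5 the PHASE twin column (β | arctan λ), §6 the COORDINATE column (β | λ)

(lens-4 g29 `SRLLogLiouvilleColumn.lean`, sha256 82cb1698…4525, farm rc 0 · 0 warn · 0 sorry · axioms std; critic VERDICT STATUS L1591 (3): optional PORT GO LOW via the census lane,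
`Theorems/RootDecomp1BSRLLogLiouville01/02 --supports stmt-Schanuel-32406` (SRL SharpRelativeLindemann); port by census-1 gen 14 in two parts (cut at §4; the two `set_option linter.*` lines dropped;
`liouville_liouvilleNumber_ten`, `liouvilleNumber_ten_pos`, `lambdaH_pos` made private; six private one-liners documented); statements and proofs verbatim; `hLW : LWMeasure` stays a binder. Nothing here proves Schanuel; rung 0.)
-/

noncomputable section

open Complex IntermediateField

namespace Summit.Schanuel.Schanuel.Theorems.RootDecomp1BSRLLogLiouville

open Summit.Schanuel.Schanuel.Theorems.RootDecomp1BFedFlagCore (KleinIH polarDeg baseField polarField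
  coe_mem_adjoin_of_mem_span coe_mem_polarField coe_mul_I_mem_polarField exp_coe_mem_polarField exp_coe_mul_I_mem_polarField)
open Summit.Schanuel.Schanuel.Theorems.RootDecomp1BDefectFloorDefs (SharpRelativeLindemannAt)
open Summit.Schanuel.Schanuel.Theorems.RootDecomp1BDefectFloorCells (polarDeg_le_two_mul_of_algebraic
  isAlgebraic_of_mem_span_algebraic isAlgebraic_polarExp linearIndependent_polar natCast_le_trdeg_of_algebraicIndependent)
open Summit.Schanuel.Schanuel.Theorems.RootDecomp1KHyper (LWMeasure MvPolyMeasure mvPolyMeasure_exp_of_LW mvlen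
  transcendental_ofReal_of_liouville
  mvlen_nonneg mvspecialise mvaeval_mvspecialise totalDegree_mvspecialise_le mvlen_mvspecialise_le exists_int_mvrelation
  exists_ball_eval_ne_zero exists_lipschitz_at_root)
open Summit.Schanuel.Schanuel.Theorems.RootDecomp1KHyper.HyperCell (HyperLiouville lambdaH summable_lambdaH
  hyperLiouville_lambdaH MvWeakMeasure mvaeval_ne_zero_of_mvWeakMeasure algebraicIndependent_of_mvWeakMeasure)

section

variable {m : ℕ}

/-! ## §4 Flagships: the tree's explicit hyper-Liouville constant `λ_H = Σ_k 2^{-a_k}` and Liouville's constant `L₁₀ = Σ_k 10^{-k!}` -/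

/-- `λ_H > 0`. -/
private theorem lambdaH_pos : 0 < lambdaH :=
  summable_lambdaH.tsum_pos (fun _ => by positivity) 0 (by positivity)

/-- Liouville's constant `L₁₀ = Σ_k 10^{-k!}` is a Liouville number (Mathlib) … -/
private theorem liouville_liouvilleNumber_ten : Liouville (liouvilleNumber 10) := by
  simpa using liouville_liouvilleNumber (m := 10) (by norm_num)

/-- … and positive. -/
private theorem liouvilleNumber_ten_pos : 0 < liouvilleNumber 10 :=
  (LiouvilleNumber.summable (by norm_num : (1 : ℝ) < 10)).tsum_pos (fun _ => by positivity) 0 (by positivity)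

/-- `log λ_H` is transcendental (mod `hLW`). -/
theorem transcendental_log_lambdaH (hLW : LWMeasure) : Transcendental ℚ ((Real.log lambdaH : ℝ) : ℂ) :=
  transcendental_log_of_liouville hLW hyperLiouville_lambdaH.liouville lambdaH_pos

/-- `log L₁₀` is transcendental (mod `hLW`). -/
theorem transcendental_log_liouvilleNumber_ten (hLW : LWMeasure) :
    Transcendental ℚ ((Real.log (liouvilleNumber 10) : ℝ) : ℂ) :=
  transcendental_log_of_liouville hLW liouville_liouvilleNumber_ten liouvilleNumber_ten_pos

/-- The one-term tuple `(1)` consists of algebraic numbers. -/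
private theorem isAlgebraic_one_vec : ∀ j : Fin 1, IsAlgebraic ℚ (((![(1 : ℝ)] : Fin 1 → ℝ) j : ℝ) : ℂ) := by
  intro j
  fin_cases j
  simpa using isAlgebraic_one

/-- The one-term tuple `(1)` is `ℚ`-linearly independent. -/
private theorem linearIndependent_one_vec : LinearIndependent ℚ (![(1 : ℝ)] : Fin 1 → ℝ) :=
  linearIndependent_unique_iff.mpr (by simp)

/-- `√2` is algebraic (as a complex number). -/
private theorem isAlgebraic_sqrt_two : IsAlgebraic ℚ ((Real.sqrt 2 : ℝ) : ℂ) := by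
  refine IsAlgebraic.of_pow two_pos ?_
  have e : ((Real.sqrt 2 : ℝ) : ℂ) ^ 2 = (2 : ℕ) := by
    rw [← Complex.ofReal_pow, Real.sq_sqrt (by norm_num : (0 : ℝ) ≤ 2)]
    push_cast
    rfl
  rw [e]
  exact isAlgebraic_nat 2

/-- The one-term tuple `(√2)` consists of algebraic numbers. -/
private theorem isAlgebraic_sqrt_two_vec :
    ∀ j : Fin 1, IsAlgebraic ℚ (((![Real.sqrt 2] : Fin 1 → ℝ) j : ℝ) : ℂ) := by
  intro j
  fin_cases j
  simpa using isAlgebraic_sqrt_two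

/-- The one-term tuple `(√2)` is `ℚ`-linearly independent. -/
private theorem linearIndependent_sqrt_two_vec : LinearIndependent ℚ (![Real.sqrt 2] : Fin 1 → ℝ) :=
  linearIndependent_unique_iff.mpr (by simp)

/-- FLAGSHIP `(1 | log λ_H)`: the storey-2 SRL cell at `r = (1, log λ_H)` is decided — `t(1, log λ_H) ≥ 3`
(e, e^i, λ_H algebraically independent), (1, log λ_H) ℚ-free, hyperplane (1) sharp.  X(2) there —
`trdeg ℚ(e, e^i, λ_H, log λ_H, λ_H^i) ≥ 4` — is OPEN. -/
theorem cell_one_log_lambdaH (hLW : LWMeasure) :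
    LinearIndependent ℚ (Fin.snoc ![(1 : ℝ)] (Real.log lambdaH) : Fin 2 → ℝ) ∧
      polarDeg (Fin.init (Fin.snoc ![(1 : ℝ)] (Real.log lambdaH) : Fin 2 → ℝ)) ≤ ((1 + 1 : ℕ) : Cardinal) ∧
      ((1 + 1 + 1 : ℕ) : Cardinal) ≤ polarDeg (Fin.snoc ![(1 : ℝ)] (Real.log lambdaH) : Fin 2 → ℝ) ∧
      SharpRelativeLindemannAt 1 (Fin.snoc ![(1 : ℝ)] (Real.log lambdaH) : Fin 2 → ℝ) :=
  cell_snoc_log_of_hyperLiouville hLW ![(1 : ℝ)] isAlgebraic_one_vec linearIndependent_one_vec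
    hyperLiouville_lambdaH lambdaH_pos

/-- FLAGSHIP `(√2 | log L₁₀)` with Liouville's own constant: `t(√2, log L₁₀) ≥ 3` (e^{√2}, e^{i√2}, L₁₀ algebraically
independent).  X(2) there is OPEN. -/
theorem cell_sqrt_two_log_liouvilleNumber_ten (hLW : LWMeasure) :
    LinearIndependent ℚ (Fin.snoc ![Real.sqrt 2] (Real.log (liouvilleNumber 10)) : Fin 2 → ℝ) ∧
      polarDeg (Fin.init (Fin.snoc ![Real.sqrt 2] (Real.log (liouvilleNumber 10)) : Fin 2 → ℝ)) ≤
        ((1 + 1 : ℕ) : Cardinal) ∧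
      ((1 + 1 + 1 : ℕ) : Cardinal) ≤
        polarDeg (Fin.snoc ![Real.sqrt 2] (Real.log (liouvilleNumber 10)) : Fin 2 → ℝ) ∧
      SharpRelativeLindemannAt 1 (Fin.snoc ![Real.sqrt 2] (Real.log (liouvilleNumber 10)) : Fin 2 → ℝ) :=
  cell_snoc_log hLW ![Real.sqrt 2] isAlgebraic_sqrt_two_vec linearIndependent_sqrt_two_vec
    liouville_liouvilleNumber_ten liouvilleNumber_ten_pos

/-- `(1, √2)` is ℚ-free (√2 irrational). -/
private theorem linearIndependent_one_sqrt_two : LinearIndependent ℚ (![(1 : ℝ), Real.sqrt 2] : Fin 2 → ℝ) := by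
  refine LinearIndependent.pair_iff.mpr fun s t hst => ?_
  rw [Rat.smul_def, Rat.smul_def, mul_one] at hst
  by_cases ht : t = 0
  · subst ht
    simp only [Rat.cast_zero, zero_mul, add_zero, Rat.cast_eq_zero] at hst
    exact ⟨hst, rfl⟩
  · exfalso
    have ht' : (t : ℝ) ≠ 0 := by exact_mod_cast ht
    have e : Real.sqrt 2 = ((-s / t : ℚ) : ℝ) := by
      push_cast
      field_simp
      linarith
    exact irrational_sqrt_two.ne_rat _ e

/-- The tuple `(1, √2)` consists of algebraic numbers. -/
private theorem isAlgebraic_one_sqrt_two_vec :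
    ∀ j : Fin 2, IsAlgebraic ℚ (((![(1 : ℝ), Real.sqrt 2] : Fin 2 → ℝ) j : ℝ) : ℂ) := by
  intro j
  fin_cases j
  · simpa using isAlgebraic_one
  · simpa using isAlgebraic_sqrt_two

/-- FLAGSHIP at storey 3, `(1, √2 | log λ_H)`: `t ≥ 5` (e, e^i, e^{√2}, e^{i√2}, λ_H algebraically independent). -/
theorem cell_one_sqrt_two_log_lambdaH (hLW : LWMeasure) :
    LinearIndependent ℚ (Fin.snoc ![(1 : ℝ), Real.sqrt 2] (Real.log lambdaH) : Fin 3 → ℝ) ∧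
      polarDeg (Fin.init (Fin.snoc ![(1 : ℝ), Real.sqrt 2] (Real.log lambdaH) : Fin 3 → ℝ)) ≤
        ((2 + 2 : ℕ) : Cardinal) ∧
      ((2 + 2 + 1 : ℕ) : Cardinal) ≤ polarDeg (Fin.snoc ![(1 : ℝ), Real.sqrt 2] (Real.log lambdaH) : Fin 3 → ℝ) ∧
      SharpRelativeLindemannAt 2 (Fin.snoc ![(1 : ℝ), Real.sqrt 2] (Real.log lambdaH) : Fin 3 → ℝ) :=
  cell_snoc_log_of_hyperLiouville hLW ![(1 : ℝ), Real.sqrt 2] isAlgebraic_one_sqrt_two_vec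
    linearIndependent_one_sqrt_two hyperLiouville_lambdaH lambdaH_pos

/-! ## §5 The PHASE twin: the column (β | arctan λ) — the Liouville datum fed through `e^{iu}`

On (β | log λ) the Liouville number enters F as the MODULUS exponential e^u = λ; on (β | arctan λ) it enters through the
PHASE: e^{iu} = cos u + i sin u and i ∈ F give tan u = λ ∈ F.  Same engine, same count `2m + 1`; and `arctan λ` is
transcendental too (so (β | arctan λ) is ℚ-free), by (E1) and the identity `λ (w² + 1) = −i (w² − 1)`, w = e^{i arctan λ}.
The phase column degenerates exactly where SRL is OPEN: at u with tan u ALGEBRAIC (torsion u ∈ ℚπ included, e.g. the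
recorded open cell (1 | π)) the fed datum contributes nothing. -/

/-- `i` is algebraic over `ℚ`. -/
private theorem isAlgebraic_I_rat : IsAlgebraic ℚ Complex.I :=
  IsAlgebraic.of_pow two_pos (by rw [Complex.I_sq]; exact isAlgebraic_one.neg)

/-- `tan u ∈ F(β | u)` for `u ≠ 0`: `e^{±iu} ∈ F`, `i = (iu)/u ∈ F`, `tan u = (e^{-iu} − e^{iu}) i / (e^{iu} + e^{-iu})`. -/
theorem tan_mem_polarField_snoc (β : Fin m → ℝ) {u : ℝ} (hu : u ≠ 0) :
    ((Real.tan u : ℝ) : ℂ) ∈ polarField (Fin.snoc β u : Fin (m + 1) → ℝ) := by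
  have hw : cexp (((u : ℝ) : ℂ) * Complex.I) ∈ polarField (Fin.snoc β u : Fin (m + 1) → ℝ) := by
    simpa only [Fin.snoc_last] using exp_coe_mul_I_mem_polarField (Fin.snoc β u : Fin (m + 1) → ℝ) (Fin.last m)
  have hw' : cexp (-((u : ℝ) : ℂ) * Complex.I) ∈ polarField (Fin.snoc β u : Fin (m + 1) → ℝ) := by
    rw [neg_mul, Complex.exp_neg]
    exact inv_mem hw
  have huF : ((u : ℝ) : ℂ) ∈ polarField (Fin.snoc β u : Fin (m + 1) → ℝ) := by
    simpa only [Fin.snoc_last] using coe_mem_polarField (Fin.snoc β u : Fin (m + 1) → ℝ) (Fin.last m)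
  have huI : ((u : ℝ) : ℂ) * Complex.I ∈ polarField (Fin.snoc β u : Fin (m + 1) → ℝ) := by
    simpa only [Fin.snoc_last] using coe_mul_I_mem_polarField (Fin.snoc β u : Fin (m + 1) → ℝ) (Fin.last m)
  have hI : Complex.I ∈ polarField (Fin.snoc β u : Fin (m + 1) → ℝ) := by
    have hu' : ((u : ℝ) : ℂ) ≠ 0 := by exact_mod_cast hu
    have e : Complex.I = ((u : ℝ) : ℂ) * Complex.I / ((u : ℝ) : ℂ) := by field_simp
    rw [e]
    exact div_mem huI huF
  have h2 : (2 : ℂ) ∈ polarField (Fin.snoc β u : Fin (m + 1) → ℝ) := ofNat_mem _ 2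
  rw [Complex.ofReal_tan]
  unfold Complex.tan Complex.sin Complex.cos
  exact div_mem (div_mem (mul_mem (sub_mem hw' hw) hI) h2) (div_mem (add_mem hw hw') h2)

/-- `λ = tan(arctan λ)` lies in the polar field of `(β | arctan λ)`, `λ ≠ 0` — through the PHASE `e^{i arctan λ}` and `i`. -/
theorem coe_mem_polarField_snoc_arctan (β : Fin m → ℝ) {l : ℝ} (hl0 : l ≠ 0) :
    ((l : ℝ) : ℂ) ∈ polarField (Fin.snoc β (Real.arctan l) : Fin (m + 1) → ℝ) := by
  have h := tan_mem_polarField_snoc β (u := Real.arctan l) (fun h => hl0 (Real.arctan_eq_zero_iff.mp h))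
  rwa [Real.tan_arctan] at h

/-- **(E2′)** `arctan λ` is TRANSCENDENTAL for every Liouville λ (mod `hLW`): were u = arctan λ algebraic (u ≠ 0),
(E1) at `n = 1`, `y = (iu)` would make (λ, w) algebraically independent, w = e^{iu}; but λ = tan u satisfies
`Q(λ, w) = (λ (w² + 1))² + (w² − 1)² = 0`, `Q ≠ 0` (indeed `λ (w² + 1) = −i (w² − 1)`). -/
theorem transcendental_arctan_of_liouville (hLW : LWMeasure) {l : ℝ} (hl : Liouville l) :
    Transcendental ℚ ((Real.arctan l : ℝ) : ℂ) := by
  intro halg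
  have hu0 : Real.arctan l ≠ 0 := fun h => hl.irrational.ne_zero (Real.arctan_eq_zero_iff.mp h)
  have hy : ∀ i : Fin 1,
      IsAlgebraic ℚ ((![((Real.arctan l : ℝ) : ℂ) * Complex.I] : Fin 1 → ℂ) i) := fun i => by
    fin_cases i
    exact halg.mul isAlgebraic_I_rat
  have hli : LinearIndependent ℚ (![((Real.arctan l : ℝ) : ℂ) * Complex.I] : Fin 1 → ℂ) :=
    linearIndependent_unique_iff.mpr (by
      rw [Fin.default_eq_zero, Matrix.cons_val_zero]
      exact mul_ne_zero (Complex.ofReal_ne_zero.mpr hu0) Complex.I_ne_zero)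
  have hai := algebraicIndependent_option_exp_of_LW hLW hy hli hl
  -- the non-zero polynomial Q = (X₀ (X₁² + 1))² + (X₁² − 1)² ∈ ℚ[X₀, X₁]
  set Q : MvPolynomial (Option (Fin 1)) ℚ :=
    (MvPolynomial.X none * (MvPolynomial.X (some 0) ^ 2 + 1)) ^ 2 + (MvPolynomial.X (some 0) ^ 2 - 1) ^ 2
    with hQ
  have hQ0 : Q ≠ 0 := by
    intro h0
    have h1 : MvPolynomial.aeval (fun o : Option (Fin 1) => o.elim (1 : ℚ) (fun _ => (0 : ℚ))) Q = 2 := by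
      simp only [hQ, map_add, map_pow, map_mul, map_sub, map_one, MvPolynomial.aeval_X, Option.elim_none,
        Option.elim_some]
      norm_num
    rw [h0, map_zero] at h1
    norm_num at h1
  -- the relation Q(λ, e^{i arctan λ}) = 0
  have hc : Complex.cos ((Real.arctan l : ℝ) : ℂ) ≠ 0 := by
    rw [← Complex.ofReal_cos]
    exact_mod_cast (Real.cos_arctan_pos l).ne'
  have hlC : ((l : ℝ) : ℂ) = Complex.sin ((Real.arctan l : ℝ) : ℂ) / Complex.cos ((Real.arctan l : ℝ) : ℂ) := by
    rw [← Complex.tan_eq_sin_div_cos, ← Complex.ofReal_tan, Real.tan_arctan]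
  have key : ((l : ℝ) : ℂ) * (cexp (((Real.arctan l : ℝ) : ℂ) * Complex.I) ^ 2 + 1) =
      -(Complex.I * (cexp (((Real.arctan l : ℝ) : ℂ) * Complex.I) ^ 2 - 1)) := by
    rw [Complex.exp_mul_I, hlC, div_mul_eq_mul_div, div_eq_iff hc]
    linear_combination (Complex.sin ((Real.arctan l : ℝ) : ℂ) ^ 3 +
        2 * Complex.cos ((Real.arctan l : ℝ) : ℂ) ^ 2 * Complex.sin ((Real.arctan l : ℝ) : ℂ) +
        Complex.cos ((Real.arctan l : ℝ) : ℂ) * Complex.sin ((Real.arctan l : ℝ) : ℂ) ^ 2 * Complex.I) * Complex.I_sq +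
      (Complex.I * Complex.cos ((Real.arctan l : ℝ) : ℂ) - Complex.sin ((Real.arctan l : ℝ) : ℂ)) *
        Complex.sin_sq_add_cos_sq ((Real.arctan l : ℝ) : ℂ)
  have hrel : MvPolynomial.aeval
      (fun o : Option (Fin 1) => o.elim ((l : ℝ) : ℂ)
        (fun i => cexp ((![((Real.arctan l : ℝ) : ℂ) * Complex.I] : Fin 1 → ℂ) i))) Q = 0 := by
    simp only [hQ, map_add, map_pow, map_mul, map_sub, map_one, MvPolynomial.aeval_X, Option.elim_none,
      Option.elim_some, Matrix.cons_val_zero]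
    rw [key]
    linear_combination (cexp (((Real.arctan l : ℝ) : ℂ) * Complex.I) ^ 2 - 1) ^ 2 * Complex.I_sq
  exact hQ0 ((algebraicIndependent_iff.mp hai) Q hrel)

/-- **(E3′)** `(β | arctan λ)` is ℚ-FREE for β algebraic ℚ-free, λ Liouville. -/
theorem linearIndependent_snoc_arctan (hLW : LWMeasure) (β : Fin m → ℝ) (hβ : ∀ j, IsAlgebraic ℚ ((β j : ℝ) : ℂ))
    (hli : LinearIndependent ℚ β) {l : ℝ} (hl : Liouville l) :
    LinearIndependent ℚ (Fin.snoc β (Real.arctan l) : Fin (m + 1) → ℝ) :=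
  linearIndependent_finSnoc.mpr
    ⟨hli, fun hmem => transcendental_arctan_of_liouville hLW hl (isAlgebraic_of_mem_span_algebraic β hβ hmem)⟩

/-- **THE FLOOR ON THE PHASE COLUMN**: `t(β | arctan λ) ≥ 2m + 1` for β real algebraic ℚ-free, λ Liouville. -/
theorem floor_snoc_arctan (hLW : LWMeasure) (β : Fin m → ℝ) (hβ : ∀ j, IsAlgebraic ℚ ((β j : ℝ) : ℂ))
    (hli : LinearIndependent ℚ β) {l : ℝ} (hl : Liouville l) :
    ((m + m + 1 : ℕ) : Cardinal) ≤ polarDeg (Fin.snoc β (Real.arctan l) : Fin (m + 1) → ℝ) := by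
  have hai := algebraicIndependent_option_exp_of_LW hLW (isAlgebraic_polarExp β hβ)
    (linearIndependent_polar hli) hl
  have hmem : ∀ o : Option (Fin (m + m)),
      o.elim ((l : ℝ) : ℂ)
          (fun i => cexp (Fin.append (fun j => ((β j : ℝ) : ℂ)) (fun j => ((β j : ℝ) : ℂ) * Complex.I) i)) ∈
        polarField (Fin.snoc β (Real.arctan l) : Fin (m + 1) → ℝ) := by
    rintro (_ | i)
    · exact coe_mem_polarField_snoc_arctan β hl.irrational.ne_zero
    · exact exp_polarExp_mem_polarField_snoc β (Real.arctan l) i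
  exact natCast_le_trdeg_of_algebraicIndependent (hai.comp _ (finSuccEquiv (m + m)).injective)
    (fun k => hmem (finSuccEquiv (m + m) k))

/-- **THE CELL `SharpRelativeLindemannAt m (β | arctan λ)` IS A THEOREM** (mod `hLW`), with all its structural
hypotheses discharged. -/
theorem cell_snoc_arctan (hLW : LWMeasure) (β : Fin m → ℝ) (hβ : ∀ j, IsAlgebraic ℚ ((β j : ℝ) : ℂ))
    (hli : LinearIndependent ℚ β) {l : ℝ} (hl : Liouville l) :
    LinearIndependent ℚ (Fin.snoc β (Real.arctan l) : Fin (m + 1) → ℝ) ∧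
      polarDeg (Fin.init (Fin.snoc β (Real.arctan l) : Fin (m + 1) → ℝ)) ≤ ((m + m : ℕ) : Cardinal) ∧
      ((m + m + 1 : ℕ) : Cardinal) ≤ polarDeg (Fin.snoc β (Real.arctan l) : Fin (m + 1) → ℝ) ∧
      SharpRelativeLindemannAt m (Fin.snoc β (Real.arctan l) : Fin (m + 1) → ℝ) :=
  ⟨linearIndependent_snoc_arctan hLW β hβ hli hl, sharp_init_snoc β hβ _, floor_snoc_arctan hLW β hβ hli hl,
    fun _ _ _ => floor_snoc_arctan hLW β hβ hli hl⟩

/-- FLAGSHIP on the phase column, `(1 | arctan L₁₀)`: `t ≥ 3` (e, e^i, L₁₀ algebraically independent in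
F = ℚ(1, arctan L₁₀, i, …, e, e^i, e^{arctan L₁₀}, e^{i arctan L₁₀})`).  X(2) there is OPEN. -/
theorem cell_one_arctan_liouvilleNumber_ten (hLW : LWMeasure) :
    LinearIndependent ℚ (Fin.snoc ![(1 : ℝ)] (Real.arctan (liouvilleNumber 10)) : Fin 2 → ℝ) ∧
      polarDeg (Fin.init (Fin.snoc ![(1 : ℝ)] (Real.arctan (liouvilleNumber 10)) : Fin 2 → ℝ)) ≤
        ((1 + 1 : ℕ) : Cardinal) ∧
      ((1 + 1 + 1 : ℕ) : Cardinal) ≤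
        polarDeg (Fin.snoc ![(1 : ℝ)] (Real.arctan (liouvilleNumber 10)) : Fin 2 → ℝ) ∧
      SharpRelativeLindemannAt 1 (Fin.snoc ![(1 : ℝ)] (Real.arctan (liouvilleNumber 10)) : Fin 2 → ℝ) :=
  cell_snoc_arctan hLW ![(1 : ℝ)] isAlgebraic_one_vec linearIndependent_one_vec liouville_liouvilleNumber_ten

/-! ## §6 The COORDINATE column (β | λ): the zeroth member of the family

Here the Liouville datum IS the new coordinate (`u = λ`), so `λ ∈ F` trivially and (E1) gives the floor at once.  HONEST
LABEL: for hyper-Liouville λ this is lens 6's coordinate-Liouville cell `SB (2m+1) (β, iβ, λ)` read through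
`polarDeg` monotonicity (COROLLARY); for plain Liouville λ and `m ≥ 1` it needs the several-variable kernel (E1).
Recorded for completeness of the EC row; the log / arctan columns (§3, §5) are the members whose datum is NOT a
coordinate or coordinate ratio of the polar tuple. -/

/-- **(E3″)** `(β | λ)` is ℚ-free: λ is transcendental (Liouville), `span_ℚ(β) ⊂ ℚ̄`. -/
theorem linearIndependent_snoc_liouville (β : Fin m → ℝ) (hβ : ∀ j, IsAlgebraic ℚ ((β j : ℝ) : ℂ))
    (hli : LinearIndependent ℚ β) {l : ℝ} (hl : Liouville l) :
    LinearIndependent ℚ (Fin.snoc β l : Fin (m + 1) → ℝ) :=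
  linearIndependent_finSnoc.mpr
    ⟨hli, fun hmem => transcendental_ofReal_of_liouville hl (isAlgebraic_of_mem_span_algebraic β hβ hmem)⟩

/-- **THE FLOOR on the coordinate column**: `t(β | λ) ≥ 2m + 1` for β real algebraic ℚ-free, λ Liouville (mod `hLW`). -/
theorem floor_snoc_liouville (hLW : LWMeasure) (β : Fin m → ℝ) (hβ : ∀ j, IsAlgebraic ℚ ((β j : ℝ) : ℂ))
    (hli : LinearIndependent ℚ β) {l : ℝ} (hl : Liouville l) :
    ((m + m + 1 : ℕ) : Cardinal) ≤ polarDeg (Fin.snoc β l : Fin (m + 1) → ℝ) := by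
  have hai := algebraicIndependent_option_exp_of_LW hLW (isAlgebraic_polarExp β hβ)
    (linearIndependent_polar hli) hl
  have hmem : ∀ o : Option (Fin (m + m)),
      o.elim ((l : ℝ) : ℂ)
          (fun i => cexp (Fin.append (fun j => ((β j : ℝ) : ℂ)) (fun j => ((β j : ℝ) : ℂ) * Complex.I) i)) ∈
        polarField (Fin.snoc β l : Fin (m + 1) → ℝ) := by
    rintro (_ | i)
    · have h := coe_mem_polarField (Fin.snoc β l : Fin (m + 1) → ℝ) (Fin.last m)
      rw [Fin.snoc_last] at h
      exact h
    · exact exp_polarExp_mem_polarField_snoc β l i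
  exact natCast_le_trdeg_of_algebraicIndependent (hai.comp _ (finSuccEquiv (m + m)).injective)
    (fun k => hmem (finSuccEquiv (m + m) k))

/-- **THE CELL `SharpRelativeLindemannAt m (β | λ)` IS A THEOREM** (mod `hLW`), λ any Liouville number, with all its
structural hypotheses discharged. -/
theorem cell_snoc_liouville (hLW : LWMeasure) (β : Fin m → ℝ) (hβ : ∀ j, IsAlgebraic ℚ ((β j : ℝ) : ℂ))
    (hli : LinearIndependent ℚ β) {l : ℝ} (hl : Liouville l) :
    LinearIndependent ℚ (Fin.snoc β l : Fin (m + 1) → ℝ) ∧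
      polarDeg (Fin.init (Fin.snoc β l : Fin (m + 1) → ℝ)) ≤ ((m + m : ℕ) : Cardinal) ∧
      ((m + m + 1 : ℕ) : Cardinal) ≤ polarDeg (Fin.snoc β l : Fin (m + 1) → ℝ) ∧
      SharpRelativeLindemannAt m (Fin.snoc β l : Fin (m + 1) → ℝ) :=
  ⟨linearIndependent_snoc_liouville β hβ hli hl, sharp_init_snoc β hβ _, floor_snoc_liouville hLW β hβ hli hl,
    fun _ _ _ => floor_snoc_liouville hLW β hβ hli hl⟩

/-- FLAGSHIP on the coordinate column, `(√2 | L₁₀)`: `t ≥ 3`. -/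
theorem cell_sqrt_two_liouvilleNumber_ten (hLW : LWMeasure) :
    LinearIndependent ℚ (Fin.snoc ![Real.sqrt 2] (liouvilleNumber 10) : Fin 2 → ℝ) ∧
      polarDeg (Fin.init (Fin.snoc ![Real.sqrt 2] (liouvilleNumber 10) : Fin 2 → ℝ)) ≤
        ((1 + 1 : ℕ) : Cardinal) ∧
      ((1 + 1 + 1 : ℕ) : Cardinal) ≤ polarDeg (Fin.snoc ![Real.sqrt 2] (liouvilleNumber 10) : Fin 2 → ℝ) ∧
      SharpRelativeLindemannAt 1 (Fin.snoc ![Real.sqrt 2] (liouvilleNumber 10) : Fin 2 → ℝ) :=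
  cell_snoc_liouville hLW ![Real.sqrt 2] isAlgebraic_sqrt_two_vec linearIndependent_sqrt_two_vec
    liouville_liouvilleNumber_ten

end

end Summit.Schanuel.Schanuel.Theorems.RootDecomp1BSRLLogLiouville
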